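import Summits.AnomalousDissipation.AnomalousDissipation.Theorems.SolenoidalFractalHomogenisationLagrangianCarrierAnalyticTowerStep
import HarnessLib

/-!
# Analytic tower of a Lagrangian lattice carrier, IV: THE INDUCTION — uniform analyticity of every Lagrangian level
# (helper for K1L_D `stmt-AnomalousDissipation-27980`, W3-E (ii) `stub_effectiveFrameEnergyL_bandKill`; `--supports`)

Summits-side helper file (everything proved; no definitions, no named facts). MAIN RESULT `analytic_tower`: for every design `W`
(pre-stretch `M`) there are constants `ρ_* , C_b, θ_H > 0` such that every `LPermissible`, `Regular` Lagrangian lattice carrier `E` with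
`E.design = W.stretch M`, strain ceiling `θ (i+1) ≤ θ_H` and separation `N_m² ≤ N_{m+1}` has ALL its Lagrangian levels real analytic,
uniformly, at the natural radius: `⟦(b (i+1) t)_c⟧_{n, ρ_* N_{i+1}} ≤ C_b · a_{i+1}/N_{i+1}` for every level `i`, time `t`, component `c`
and order `n` (Armstrong–Vicol App. A (A.1) seminorms). Proof: induction on the level with `…AnalyticTowerStep.level_step`
(`b 1 = level 1` is the base, `…AnalyticLevel`); the radius constants obey `ρ_{i+1} = max(ρ_i, 13248 ρ_i N_{i+1}/N_{i+2} + 183 λ_W)`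
and stay below `ρ_* = λ_W · 6807¹⁴` because `N_{i+1}/N_{i+2} ≤ min(1/2, 2^{−(i+1)})` (`2N_m ≤ N_{m+1}`, `N_m² ≤ N_{m+1}`):
growth by at most `6807` per level while `i ≤ 14`, contraction afterwards (§1). This is input (H) of the band-kill clause (ii):
with `…TorusCubeJackson` it yields the prefactor-free spectral tails of `partialSum m` on refresh windows. Infrastructure for route-1's rung
leaf F-D1.A0 (a frontier FORMAL rung); NOT a proof of anomalous dissipation.
-/

set_option linter.dupNamespace false

noncomputable section

namespace Summit.AnomalousDissipation.AnomalousDissipation.Theorems.SolenoidalFractalHomogenisation.LagrangianCarrierAnalytic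

open Set Function Filter Topology
open scoped ContDiff
open Literature.Analysis Literature.Analysis.ODE
open Literature.Analysis.FunctionSpaces Literature.Analysis.FunctionSpaces.Torus
open Literature.Analysis.FluidPDE Literature.Analysis.FluidPDE.LatticeShear

variable {k : ℕ}

/-! ## §1 Arithmetic of the radius constants -/

/-- `2^i ≤ N_i` along a permissible cascade (`N_0 = 1`, `2N_m ≤ N_{m+1}`). [cite: ArmstrongVicol2025, §3 (3.42)–(3.43)] -/
theorem two_pow_le_N (D : FractalCarrierData k) (h0 : D.N 0 = 1) (h2 : ∀ m, 2 * D.N m ≤ D.N (m + 1)) (i : ℕ) :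
    2 ^ i ≤ D.N i := by
  induction i with
  | zero => rw [h0]; norm_num
  | succ i ih => calc 2 ^ (i + 1) = 2 * 2 ^ i := by ring
      _ ≤ 2 * D.N i := Nat.mul_le_mul_left 2 ih
      _ ≤ D.N (i + 1) := h2 i

/-- **The radius recursion stays bounded.** If `ρ 0 = λ > 0`, `ρ (i+1) = max (ρ i) (13248 ρ i q i + 183 λ)` with `q i ≤ 1/2` and
`q i ≤ (1/2)^(i+1)`, then `λ ≤ ρ i ≤ λ · 6807¹⁴` for all `i`. [cite: ArmstrongVicol2025, App. A Prop. 7.6 (the radius `R_g(1 + d C_g R_h)` iterated)] -/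
theorem radius_rec_bounds {lam : ℝ} (hlam : 0 < lam) {q : ℕ → ℝ} (hq2 : ∀ i, q i ≤ 1 / 2)
    (hqi : ∀ i, q i ≤ (1 / 2) ^ (i + 1)) (ρ : ℕ → ℝ) (h0 : ρ 0 = lam)
    (hsucc : ∀ i, ρ (i + 1) = max (ρ i) (13248 * ρ i * q i + 183 * lam)) :
    ∀ i, lam ≤ ρ i ∧ ρ i ≤ lam * 6807 ^ 14 := by
  -- monotonicity and the lower bound
  have hmono : ∀ i, ρ i ≤ ρ (i + 1) := fun i => by rw [hsucc]; exact le_max_left _ _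
  have hlow : ∀ i, lam ≤ ρ i := by
    intro i; induction i with
    | zero => rw [h0]
    | succ i ih => exact ih.trans (hmono i)
  -- the two-phase bound `ρ i ≤ lam · 6807 ^ (min i 14)`
  have key : ∀ i, ρ i ≤ lam * 6807 ^ (min i 14) := by
    intro i
    induction i with
    | zero => simp [h0]
    | succ i ih =>
      have hρi0 : 0 ≤ ρ i := hlam.le.trans (hlow i)
      rcases Nat.lt_or_ge i 14 with hi | hi
      · -- growth phase: `ρ (i+1) ≤ 6807 ρ i`
        have hmin : min (i + 1) 14 = min i 14 + 1 := by
          rw [Nat.min_eq_left (by omega), Nat.min_eq_left (by omega)]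
        rw [hsucc, hmin, pow_succ]
        refine max_le ?_ ?_
        · calc ρ i ≤ lam * 6807 ^ min i 14 := ih
            _ ≤ lam * 6807 ^ min i 14 * 6807 := le_mul_of_one_le_right (by positivity) (by norm_num)
            _ = lam * (6807 ^ min i 14 * 6807) := by ring
        · calc 13248 * ρ i * q i + 183 * lam ≤ 13248 * ρ i * (1 / 2) + 183 * ρ i := by
                gcongr
                · exact hq2 i
                · exact hlow i
            _ = 6807 * ρ i := by ring
            _ ≤ 6807 * (lam * 6807 ^ min i 14) := by gcongr
            _ = lam * (6807 ^ min i 14 * 6807) := by ring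
      · -- contraction phase: `13248 q i ≤ 1/2`
        have hmin : min (i + 1) 14 = 14 := Nat.min_eq_right (by omega)
        have hmin' : min i 14 = 14 := Nat.min_eq_right hi
        rw [hmin' ] at ih
        rw [hsucc, hmin]
        refine max_le ih ?_
        have hq' : 13248 * q i ≤ 1 / 2 := by
          have h1 : q i ≤ (1 / 2 : ℝ) ^ (i + 1) := hqi i
          have h2 : (1 / 2 : ℝ) ^ (i + 1) ≤ (1 / 2) ^ 15 := pow_le_pow_of_le_one (by norm_num) (by norm_num) (by omega)
          nlinarith
        have h366 : (366 : ℝ) ≤ 6807 ^ 14 := by norm_num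
        calc 13248 * ρ i * q i + 183 * lam = ρ i * (13248 * q i) + 183 * lam := by ring
          _ ≤ ρ i * (1 / 2) + 183 * lam := by gcongr
          _ ≤ lam * 6807 ^ 14 * (1 / 2) + lam * 6807 ^ 14 * (1 / 2) := by
              refine add_le_add (by gcongr) ?_
              nlinarith
          _ = lam * 6807 ^ 14 := by ring
  intro i
  refine ⟨hlow i, (key i).trans ?_⟩
  exact mul_le_mul_of_nonneg_left (pow_le_pow_right₀ (by norm_num) (Nat.min_le_right i 14)) hlam.le

/-! ## §2 The base level `b 1 = level 1` -/

/-- **Level one is Eulerian**: `b 1 t = level 1 t` (the flow of `b_0 = 0` is the identity). [cite: ArmstrongVicol2025, §2.2 (PDF p. 18: b_0 = 0, b_1 = v_1)] -/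
theorem b_one_eq_level (E : LagrangianLatticeCarrier k) (hL : E.IsLagrangian) (hR : E.LevelRegular) (t : ℝ) (x : UnitAddTorus (Fin 3)) :
    E.b 1 t x = E.toFractalCarrierData.level 1 t x := by
  have ht : t ∈ E.window (0 + 1) ⌊t / E.refresh 1⌋ := LagrangianCarrierConstruction.mem_window_floor E 1 t
  have h := b_succ_eq_comp_inv E hL hR 0 ⌊t / E.refresh 1⌋ ht x
  have hd : ∀ t' s', E.disp 0 t' s' = fun _ => 0 := fun t' s' => funext fun y => E.disp_zero_of_isFlow (hL 0).1 t' s' y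
  have hD : ∀ t' s' y, E.flowDeriv 0 t' s' y = ContinuousLinearMap.id ℝ _ := by
    intro t' s' y
    unfold LagrangianLatticeCarrier.flowDeriv
    rw [hd]
    have : Torus.lift (fun _ : UnitAddTorus (Fin 3) => (0 : EuclideanSpace ℝ (Fin 3))) =
        fun _ => (0 : EuclideanSpace ℝ (Fin 3)) := rfl
    rw [this, fderiv_const_apply, add_zero]
  rw [h, hD, hd]
  have h0 : proj (0 : EuclideanSpace ℝ (Fin 3)) = (0 : UnitAddTorus (Fin 3)) := by
    funext i; simp [proj]
  simp only [h0, add_zero, ContinuousLinearMap.id_apply]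

/-! ## §3 The tower -/

/-- **THE ANALYTIC TOWER.** For every design `W` and pre-stretch `M` there are `ρ_* > 0` (radius constant), `C_b > 0` (amplitude constant)
and `θ_H > 0` (strain ceiling) such that for every Lagrangian lattice carrier `E` with `E.design = W.stretch M`, `LPermissible`, `Regular`,
`θ (i+1) ≤ θ_H` for all `i` and `N_m² ≤ N_{m+1}` for all `m`: for every level `i`, time `t`, component `c` and order `n`,
`⟦(b (i+1) t)_c⟧_{n, ρ_* N_{i+1}} ≤ C_b · a_{i+1}/N_{i+1}` — all Lagrangian levels are real analytic with radius `≳ 1/(ρ_* N_{i+1})`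
and amplitude `≲ a_{i+1}/N_{i+1}`, uniformly. Explicitly `ρ_* = 2πΛ_W · 6807¹⁴`, `C_b = 216 · (9/2) k/(2π)`, `θ_H = 1/(36 C_b ρ_*)`.
[cite: ArmstrongVicol2025, App. A (A.1), Prop. 7.6, Lemma 7.1, Prop. 7.11; §2.2 (PDF p. 18); §5.1] -/
theorem analytic_tower (k : ℕ) (W : LatticeWord k) (M : ℝ) (hM : 0 < M) :
    ∃ ρs : ℝ, 0 < ρs ∧ ∃ Cb : ℝ, 0 < Cb ∧ ∃ θH : ℝ, 0 < θH ∧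
      ∀ E : LagrangianLatticeCarrier k, E.design = W.stretch M hM → E.LPermissible → E.Regular →
        (∀ i, E.θ (i + 1) ≤ θH) → (∀ m, E.N m ^ 2 ≤ E.N (m + 1)) →
        ∀ (i : ℕ) (t : ℝ) (c : Fin 3) (n : ℕ),
          dnorm n (ρs * E.N (i + 1)) (fun x => E.b (i + 1) t x c) ≤ Cb * (E.a (i + 1) / E.N (i + 1)) := by
  set lam : ℝ := 2 * Real.pi * ∑ l, ‖latticeVec (W.phase l).m‖ with hlam
  have hk1 : (1 : ℝ) ≤ k := by have := W.pos; exact_mod_cast this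
  have hlam0 : 0 < lam := by have := one_le_sum_norm_latticeVec W; rw [hlam]; positivity
  set Cb : ℝ := 216 * (9 / 2 * (k / (2 * Real.pi))) with hCb
  have hCb0 : 0 < Cb := by rw [hCb]; positivity
  set ρs : ℝ := lam * 6807 ^ 14 with hρs
  have hρs0 : 0 < ρs := by positivity
  refine ⟨ρs, hρs0, Cb, hCb0, 1 / (36 * Cb * ρs), by positivity, ?_⟩
  intro E hdes hLP hReg hθ hsq i t c n
  have hL : E.IsLagrangian := hLP.isLagrangian
  have hR : E.LevelRegular := hReg.levelRegular
  have hP := hLP.permissible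
  have hN0 : E.N 0 = 1 := hP.1
  have hN2 : ∀ m, 2 * E.N m ≤ E.N (m + 1) := hP.2.2.1
  have hstrain : ∀ m, E.strain m ≤ E.θ (m + 1) := hLP.strain_le
  have hN : ∀ m, (0 : ℝ) < E.N m := fun m => by exact_mod_cast E.N_pos m
  -- the design budget of `E` is that of `W`
  have hlamE : 2 * Real.pi * ∑ l, ‖latticeVec (E.design.phase l).m‖ = lam := by
    rw [hlam, hdes]; rfl
  -- the radius sequence
  set q : ℕ → ℝ := fun i => (E.N (i + 1) : ℝ) / E.N (i + 2) with hq
  let ρ : ℕ → ℝ := fun i => Nat.rec (motive := fun _ => ℝ) lam (fun i r => max r (13248 * r * q i + 183 * lam)) i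
  have hρ0 : ρ 0 = lam := rfl
  have hρsucc : ∀ i, ρ (i + 1) = max (ρ i) (13248 * ρ i * q i + 183 * lam) := fun i => rfl
  have hq2 : ∀ i, q i ≤ 1 / 2 := by
    intro i
    rw [hq, div_le_iff₀ (hN _)]
    have : (2 : ℝ) * E.N (i + 1) ≤ E.N (i + 2) := by exact_mod_cast hN2 (i + 1)
    linarith
  have hqi : ∀ i, q i ≤ (1 / 2) ^ (i + 1) := by
    intro i
    have h2i : (2 : ℝ) ^ (i + 1) ≤ E.N (i + 1) := by exact_mod_cast two_pow_le_N E.toFractalCarrierData hN0 hN2 (i + 1)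
    have hsq' : ((E.N (i + 1) : ℝ)) ^ 2 ≤ E.N (i + 2) := by exact_mod_cast hsq (i + 1)
    rw [hq, div_le_iff₀ (hN _), one_div_pow, div_mul_eq_mul_div, one_mul, le_div_iff₀ (by positivity)]
    nlinarith [hN (i + 1)]
  have hρb := radius_rec_bounds hlam0 hq2 hqi ρ hρ0 hρsucc
  have hρpos : ∀ j, 0 < ρ j := fun j => hlam0.trans_le (hρb j).1
  have hρmono' : Monotone ρ := monotone_nat_of_le_succ fun i => by rw [hρsucc]; exact le_max_left _ _
  -- the induction on levels
  have main : ∀ i, ∀ j, j ≤ i → ∀ (t : ℝ) (c : Fin 3) (n : ℕ),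
      dnorm n (ρ j * E.N (j + 1)) (fun x => E.b (j + 1) t x c) ≤ Cb * (E.a (j + 1) / E.N (j + 1)) := by
    intro i
    induction i with
    | zero =>
      intro j hj t c n
      obtain rfl : j = 0 := Nat.le_zero.mp hj
      have hfun : (fun x => E.b (0 + 1) t x c) = fun x => E.toFractalCarrierData.level 1 t x c := by
        funext x; rw [b_one_eq_level E hL hR t x]
      rw [hfun, hρ0]
      have hRge : 2 * Real.pi * (E.N 1 * ∑ l, ‖latticeVec (E.design.phase l).m‖) ≤ lam * E.N (0 + 1) := by
        rw [← hlamE]; ring_nf; rfl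
      refine (dnorm_level_coord_le E.toFractalCarrierData 1 t n c hRge).trans ?_
      rw [hCb]
      have ha := E.a_pos 1
      have h1 : 9 / 2 * (k * E.a 1 / (2 * Real.pi * E.N 1)) = 9 / 2 * (k / (2 * Real.pi)) * (E.a 1 / E.N 1) := by
        field_simp
      rw [h1]
      have hx : 0 ≤ 9 / 2 * (k / (2 * Real.pi)) * (E.a (0 + 1) / E.N (0 + 1)) := by positivity
      nlinarith
    | succ i ih =>
      intro j hj t c n
      rcases Nat.lt_or_ge j (i + 1) with hji | hji
      · exact ih j (Nat.lt_succ_iff.mp hji) t c n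
      · obtain rfl : j = i + 1 := le_antisymm hj hji
        -- the level step at level `i + 2`
        have hθi : E.θ (i + 2) ≤ 1 / (36 * (216 * (9 / 2 * (k / (2 * Real.pi)))) * ρ i) := by
          refine (hθ (i + 1)).trans ?_
          rw [← hCb]
          have hρi := hρpos i
          exact one_div_le_one_div_of_le (by positivity) (by nlinarith [(hρb i).2, hCb0])
        have hstep := level_step E hL hR hN2 hstrain i ρ hρpos (fun j hj => hρmono' hj)
          (fun j hj t c n => by rw [← hCb]; exact ih j hj t c n) hθi t c n
        rw [hlamE, ← hCb] at hstep
        -- the claimed radius dominates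
        have hrad : 13248 * (ρ i * E.N (i + 1)) + 183 * lam * E.N (i + 2) ≤ ρ (i + 1) * E.N (i + 1 + 1) := by
          rw [hρsucc]
          have h1 : 13248 * ρ i * q i + 183 * lam ≤ max (ρ i) (13248 * ρ i * q i + 183 * lam) := le_max_right _ _
          have h2 := mul_le_mul_of_nonneg_right h1 (hN (i + 2)).le
          have e : (13248 * ρ i * q i + 183 * lam) * E.N (i + 2) = 13248 * (ρ i * E.N (i + 1)) + 183 * lam * E.N (i + 2) := by
            have hN2' := (hN (i + 2)).ne'
            simp only [hq]
            field_simp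
          rw [e] at h2
          exact h2
        have hpos : 0 < 13248 * (ρ i * E.N (i + 1)) + 183 * lam * E.N (i + 2) :=
          add_pos (mul_pos (by norm_num) (mul_pos (hρpos i) (hN _))) (mul_pos (mul_pos (by norm_num) hlam0) (hN _))
        exact (dnorm_anti_radius n hpos hrad _).trans hstep
  -- conclusion at the uniform radius `ρ_* N (i+1) ≥ ρ i N (i+1)`
  have h := main i i le_rfl t c n
  have hle : ρ i * E.N (i + 1) ≤ ρs * E.N (i + 1) := mul_le_mul_of_nonneg_right (hρb i).2 (hN _).le
  exact (dnorm_anti_radius n (mul_pos (hρpos i) (hN _)) hle _).trans h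

/-- **The analytic tower, vector form**: `⟦b (i+1) t⟧_{n, ρ_* N_{i+1}} ≤ 3 C_b · a_{i+1}/N_{i+1}`. [cite: ArmstrongVicol2025, App. A (A.1); §2.2] -/
theorem analytic_tower_vec (k : ℕ) (W : LatticeWord k) (M : ℝ) (hM : 0 < M) :
    ∃ ρs : ℝ, 0 < ρs ∧ ∃ Cb : ℝ, 0 < Cb ∧ ∃ θH : ℝ, 0 < θH ∧
      ∀ E : LagrangianLatticeCarrier k, E.design = W.stretch M hM → E.LPermissible → E.Regular →
        (∀ i, E.θ (i + 1) ≤ θH) → (∀ m, E.N m ^ 2 ≤ E.N (m + 1)) →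
        ∀ (i : ℕ) (t : ℝ) (n : ℕ), dnorm n (ρs * E.N (i + 1)) (E.b (i + 1) t) ≤ Cb * (E.a (i + 1) / E.N (i + 1)) := by
  obtain ⟨ρs, hρs, Cb, hCb, θH, hθH, h⟩ := analytic_tower k W M hM
  refine ⟨ρs, hρs, 3 * Cb, by positivity, θH, hθH, fun E hdes hLP hReg hθ hsq i t n => ?_⟩
  have hN : (0 : ℝ) < E.N (i + 1) := by exact_mod_cast E.N_pos (i + 1)
  calc dnorm n (ρs * E.N (i + 1)) (E.b (i + 1) t) ≤ ∑ c : Fin 3, dnorm n (ρs * E.N (i + 1)) (fun x => E.b (i + 1) t x c) :=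
        dnorm_le_sum_coord n (by positivity) (hReg.levelRegular.isSmooth_b i t)
    _ ≤ ∑ _c : Fin 3, Cb * (E.a (i + 1) / E.N (i + 1)) := Finset.sum_le_sum fun c _ => h E hdes hLP hReg hθ hsq i t c n
    _ = 3 * Cb * (E.a (i + 1) / E.N (i + 1)) := by
        rw [Finset.sum_const, Finset.card_univ, Fintype.card_fin, nsmul_eq_mul]; push_cast; ring

end Summit.AnomalousDissipation.AnomalousDissipation.Theorems.SolenoidalFractalHomogenisation.LagrangianCarrierAnalytic

end
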